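import Summits.BirchSwinnertonDyer.BirchSwinnertonDyer.Theorems.ByReductionTypeAtTwoRankOneAtTwoOneDoorLawFirstLayerDefs
import Literature.NumberTheory.EllipticCurves.Selmer
import Literature.NumberTheory.EllipticCurves.RootNumber
import Literature.NumberTheory.EllipticCurves.AnalyticRank
import Literature.NumberTheory.EllipticCurves.BSDInvariants
import Literature.NumberTheory.EllipticCurves.ModularDegreeMinimal
import Mathlib.Analysis.Quaternion
import Mathlib.NumberTheory.Padics.PadicVal.Basic
import HarnessLib

/-!
# ES-42 — THE GROSS PERIOD MOD 2 AT A `2`-INERT DOOR IS A CM VALUE ON THE GENUS FIELD `ℚ(√−2N)`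
(cell bsd-f1-sign2, lens `-es` g33; crux `RankOneAtTwoBigImageOddLocal` of route ByReductionTypeAtTwo; statement-only workfile, sorry-free)

SETTING (as ES-40/41).  `N` an odd prime, `B = ℍ[ℚ]` (ramified at `{2, ∞}`), `O ⊆ B` an Eichler order of level `N`, `RI` its invertible right ideals,
`S = Cls(O)` (`h` classes), `A` an elliptic curve of conductor `2N` with `2`-primitive integral quaternionic eigenvector `φ : RI → ℤ` (Jacquet–Langlands),
`K = ℚ(√D)` a `2`-INERT HEEGNER DOOR (`D ≡ 5 (mod 8)`, every prime of `N` split, `D < −4`), `(ψ, I, rep)` a Gross point, `T = grossPeriod φ K ψ I rep`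
(`= Σ_{Pic 𝒪_K} φ`, one orientation; Gross: `T² ≐ L(A/K,1)√|D|/Ω`).  NEW OBJECT: the GENUS FIELD `K′ = ℚ(√−2N)` (`𝒪_{K′} = ℤ[√−2N]`, `disc = −8N`) and the
`K′`-CM classes `X′ = {[J] ∈ S : √−2N ∈ O_left(J)}` = `Fix(W₂W_N)` (`IsGenusCMIdeal`; `|X′| = h(−8N)/2` at all 112 levels of the table).

MECHANISM (MEMO-es §42; (A)(B) theorem-grade with complete informal proofs, (C) conjecture, (D) Eisenstein laws).
(A) REAL-LOCUS LEMMA.  `τ := W₂W_N ∘ (complex conjugation of embeddings)` is an involution of the Gross divisor `c(D,o)` (`h(D)` oriented points), anti-equivariant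
    for `Pic 𝒪_K`; `φ ∘ W₂W_N = w(A)·φ` (`JL`: the sign at the ramified prime `2` flips, so the eigenvalue of `[J] ↦ [J·𝔐_{2N}]` is `a₂·(−a_N) = w(A)`; table 168/168).
    Hence `T = w(A)·T`: `w(A) = −1 ⇒ T = 0` (730/730 cells) and `w(A) = +1 ⇒ T ≡ Σ_{y ∈ Fix τ} φ(y) (mod 2)`.  A fixed point is a pair `(ψ(√D), x)` of
    ANTICOMMUTING elements `b² = D`, `x² = −2N` in one left order (`(D, −2N)_ℚ ≅ B` forces every prime of `D` to split in `K′`); so `Fix τ ⊆ X′`,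
    `#Fix τ = #Pic(𝒪_K)[2] = 2^{t−1}` or `0` (`= 1` exactly when `|D|` is prime), and the fixed point of the prime door `−q` is the `K′`-CM point `x₀^σ` with
    `σ² ∈ C·[𝔮]^{±1}` (`𝔮 ∣ q` in `K′`): `T(−q) mod 2` DEPENDS ONLY ON THE CLASS PAIR `{[𝔮],[𝔮]⁻¹} ⊂ Cl(−8N)` (FROBENIUS-CLASS LAW, 56/56 coincidence groups).
(B) HECKE RECURSION ON `X′`.  For a prime `ℓ ∤ 2N` the `ℓ+1` `T_ℓ`-neighbours of a `K′`-CM class are CM points of conductor `ℓ` permuted freely by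
    `(𝒪_{K′}/ℓ)^×/𝔽_ℓ^×`, whose element `[√−2N]` acts as `W₂W_N`; so for `ℓ` INERT in `K′` they pair off into `{j, W₂W_N j}` and `a_ℓ(A)·φ(x) = Σ φ(j) ≡ 0`:
    ONE INERT `ℓ` WITH `a_ℓ(A)` ODD FORCES `φ` EVEN ON ALL OF `X′`, hence (A) `T` even at EVERY `2`-inert door, prime or composite, any orientation
    (117/117 eigenvectors with a witness `ℓ ≤ 47`; 297/297 + all `w = −1` cells).  Such `ℓ` exists (Chebotarev) unless `ρ̄_{A,2}` is reducible or induced from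
    `K′`, i.e. unless `A(ℚ)[2] ≠ 0` or (`v₂(Δ_A)` odd ∧ `Δ_A < 0`, "`K′`-dihedral": `ℚ(√Δ_A) = K′`): so ES-41's conjectures E♯ (peu ramifié ⇒ even) and R♭ (très
    ramifié ∧ `Δ_A > 0` ⇒ even) are COROLLARIES of (B).
(C) THE DIHEDRAL RESIDUE (conjecture).  For `K′`-dihedral `A` the recursion (split `ℓ`: `ā_ℓ f(σ) = f(σ𝔩) + f(σ𝔩⁻¹)` over `𝔽₂`, `ā_ℓ = χ₀(𝔩)+χ₀(𝔩)⁻¹` with `χ₀`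
    the cubic class-group character cutting out `ℚ(A[2])K′`) forces `φ̄|X′ = Tr_{𝔽₄/𝔽₂}(λ·χ₀)`, `λ ∈ 𝔽₄`; `λ = 0` when `L(A,1) = 0` (Gross), and the data say
    `λ ≠ 0` whenever `L(A,1) ≠ 0` (12/12 curves): then `T(D) odd ⟺ every prime q ∣ D splits in K′ and a_q(A) is odd` (rank 0: prime doors 50/50, composite 39/39;
    rank 2: 24/24 even).  Consequence of BSD-shape: `L(A^{(−q)},1) ≠ 0` for every prime `q ≡ 3 (8)`, `(−q/N) = 1`, `a_q(A)` odd — a Kriz–Li / Zhai-type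
    non-vanishing statement reached from the `2`-INERT, DEFINITE side (their `2`-adic logarithm congruence needs `2` split in the Heegner field).
(D) EISENSTEIN (`A(ℚ)[2] ≠ 0`, only `N ≡ ±1 (mod 8)` occur): `ā_ℓ = 0` makes `φ̄|X′` constant on the two GENERA of the `Pic(𝒪_{K′})`-torsor `X′`;
    `N ≡ 7 (8)`: `φ ≡ 𝟙 (mod 2)` on all of `S` (6/6), so `T(D) ≡ h(D)`; `N ≡ 1 (8)` (`[𝔭₂] ∈ Pic²`, Rédei): `T(−q) mod 2` depends only on the class of `[𝔮]`
    modulo FOURTH powers — a spin / `8`-rank symbol (22/22 pairs, composite law 9/9, inert factor ⇒ even 7/7).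
TABLE = BC5 witness: ES-40 rows `rows40_v2.jsonl` (sha16 592ee30e929658d7; 112 prime levels `11 ≤ N ≤ 2953`, 168 rational `2`-new eigenvectors, 817 `(N,D)` door
cells after R401a de-duplication, 8 cells dropped where ENGINE 40 itself flags an incomplete orientation class sum), census scripts `census42.py`/`census42b.py`
(pure python, < 60 s; `data-es/g33/`).  Which item each Prop bears on: `RankOneAtTwoBigImageOddLocal` (the odd-local / `2`-inert Heegner-door branch of
ByReductionTypeAtTwo: these laws say exactly when the definite-side period at `2` is a `2`-adic unit, i.e. when Gross–Bertolini–Darmon bounds Ш(A/K)[2^∞] with no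
`2`-adic loss).  Sources: [cite: Gross1987, §3 (11), Prop. 10.3, §11]; Kriz–Li arXiv:1606.03172 Thm. 1.4 & arXiv:1710.00294 Thm. 1.4 (`a_ℓ` odd prime twists,
`2` split); Coates–Li–Tian–Zhai doi:10.1112/plms/pdu059 and Zhai doi:10.4310/ajm.2016.v20.n3.a4 (induction on prime factors at `2`-inert twists, modular-symbol
side); Ogg's fixed-point count for `w_{2N}` + Eichler–JL for `#Fix(W₂W_N) = h(−8N)/2`; K. Martin arXiv:1701.07864 §4.3 (fixed points of `σ_p` on `Cls O` via
`tr W_p`); Takahashi doi:10.1006/jnth.2000.2614 Thm 2.3 (law E); Rédei–Reichardt (`4`-rank of `Cl(−8N)`).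
-/

open scoped Classical BigOperators Quaternion

set_option linter.dupNamespace false
set_option autoImplicit false

namespace Summit.BirchSwinnertonDyer.BirchSwinnertonDyer.Theorems.RankOneAtTwoGenusFieldCMAtTwo

open Literature.NumberTheory.EllipticCurves Literature.NumberTheory.EllipticCurves.ModularForms
  Summit.BirchSwinnertonDyer.Rank1Residual.F1Sign2
  Summit.BirchSwinnertonDyer.BirchSwinnertonDyer.Theorems.RankOneAtTwoOneDoor
  IsDedekindDomain NumberField WeierstrassCurve

/-! ## Quaternion side (verbatim ES-39/40/41, so that this workfile is self-contained) -/

/-- `O ⊆ ℍ[ℚ]` is an EICHLER ORDER OF LEVEL `N` (verbatim ES-39/40/41). -/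
def IsEichlerOrder (N : ℕ) (O : Subring ℍ[ℚ]) : Prop :=
  ∃ O₁ O₂ : Subring ℍ[ℚ],
    (∀ S : Subring ℍ[ℚ], (S = O₁ ∨ S = O₂) →
      (S.toAddSubgroup.FG ∧ (∀ d : ℍ[ℚ], ∃ m : ℤ, m ≠ 0 ∧ m • d ∈ S) ∧
        ∀ S' : Subring ℍ[ℚ], S'.toAddSubgroup.FG → S ≤ S' → S' = S)) ∧
    O = O₁ ⊓ O₂ ∧ O.toAddSubgroup.relIndex O₁.toAddSubgroup = N

/-- `RI` is THE SET OF INVERTIBLE RIGHT `O`-IDEALS of `ℍ[ℚ]` (verbatim ES-39/40/41). -/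
def IsRightIdealSet (O : Subring ℍ[ℚ]) (RI : Set (Submodule ℤ ℍ[ℚ])) : Prop :=
  ∀ J : Submodule ℤ ℍ[ℚ], J ∈ RI ↔
    (J.FG ∧ (∀ d : ℍ[ℚ], ∃ m : ℤ, m ≠ 0 ∧ m • d ∈ J) ∧
      (∀ x : ℍ[ℚ], (∀ y ∈ J, y * x ∈ J) ↔ x ∈ O) ∧
      (∃ J' : Submodule ℤ ℍ[ℚ],
        (∀ x : ℍ[ℚ], x ∈ J * J' ↔ ∀ y ∈ J, x * y ∈ J) ∧
        (∀ x : ℍ[ℚ], x ∈ J' * J ↔ x ∈ O)))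

/-- **A Gross point of `𝒪_K` with class representatives** `(ψ, I, rep)` (verbatim ES-39/40/41). -/
def GrossPoint (RI : Set (Submodule ℤ ℍ[ℚ])) (K : Type) [Field K] [NumberField K]
    (ψ : K →ₐ[ℚ] ℍ[ℚ]) (I : Submodule ℤ ℍ[ℚ])
    (rep : ClassGroup (𝓞 K) → nonZeroDivisors (Ideal (𝓞 K))) : Prop :=
  (I ∈ RI) ∧
  (∀ x : 𝓞 K, ∀ y ∈ I, ψ (x : K) * y ∈ I) ∧
  (∀ x : K, (∀ y ∈ I, ψ x * y ∈ I) → ∃ z : 𝓞 K, (z : K) = x) ∧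
  (∀ 𝔞 : ClassGroup (𝓞 K), ClassGroup.mk0 (rep 𝔞) = 𝔞)

/-- **`2`-primitive integral quaternionic eigenform of `A`** on the right ideals `RI` of an Eichler order `O` of level `N` (verbatim ES-40/41): left-unit
invariant (a function of ideal classes), Brandt–Hecke eigen with eigenvalue `a_ℓ(A)` at every prime `ℓ ∤ 2N`, and not divisible by `2`. -/
def IsIntegralEigenform (A : WeierstrassCurve ℚ) [A.IsGloballyMinimal] (N : ℕ) (O : Subring ℍ[ℚ]) (RI : Set (Submodule ℤ ℍ[ℚ]))
    (φ : Submodule ℤ ℍ[ℚ] → ℤ) : Prop :=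
  (∀ J ∈ RI, ∀ β : ℍ[ℚ], IsUnit β → φ (J.map (AddMonoidHom.mulLeft β).toIntLinearMap) = φ J) ∧
  (∀ ℓ : ℕ, ℓ.Prime → ¬ ℓ ∣ 2 * N → ∀ J ∈ RI,
    ∑ᶠ J' ∈ {J' : Submodule ℤ ℍ[ℚ] | J' ≤ J ∧ J'.toAddSubgroup.relIndex J.toAddSubgroup = ℓ ^ 2 ∧ ∀ y ∈ J', ∀ x ∈ O, y * x ∈ J'},
      φ J' = A.frobeniusTrace ℓ * φ J) ∧
  (∃ J ∈ RI, Odd (φ J))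

/-- **The Gross period** `T(φ, K) = Σ_{[𝔞] ∈ Pic 𝒪_K} φ(ψ(𝔞)·I) ∈ ℤ` (verbatim ES-40/41). -/
noncomputable def grossPeriod (φ : Submodule ℤ ℍ[ℚ] → ℤ) (K : Type) [Field K] [NumberField K]
    (ψ : K →ₐ[ℚ] ℍ[ℚ]) (I : Submodule ℤ ℍ[ℚ]) (rep : ClassGroup (𝓞 K) → nonZeroDivisors (Ideal (𝓞 K))) : ℤ :=
  ∑ 𝔞 : ClassGroup (𝓞 K), φ (Submodule.span ℤ ((fun x : 𝓞 K => ψ (x : K)) '' ((rep 𝔞 : nonZeroDivisors (Ideal (𝓞 K))) : Ideal (𝓞 K))) * I)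

/-! ## The new object: CM by the genus order `ℤ[√−2N]` -/

/-- **`J` is a GENUS-CM ideal**: the left order `O_left(J) = {x : xJ ⊆ J}` contains a square root of `−2N`, i.e. an (automatically optimal, `−8N` being
fundamental for odd squarefree `N`) embedding of `ℤ[√−2N] = 𝒪_{ℚ(√−2N)}`.  LEMMA (MEMO-es §42.1, Ogg-type): for `O` Eichler of odd prime level `N` in `ℍ[ℚ]` the
class `[J]` is fixed by the Atkin–Lehner–Brandt permutation `W₂W_N : [J] ↦ [J·𝔐_{2N}]` iff `J` is genus-CM (the element `β` with `βJ = J𝔐` has `β² = −2N·u`,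
`u` a unit of the definite order inside the field `ℚ(β)`, forcing `β² = −2N`: a unit `u ≠ ±1` generates `ℚ(i)` or `ℚ(√−3)`, where `±2Nu` is not a square);
`#{genus-CM classes} = h(−8N)/2` at all 112 levels of the table, and (v3, 2026-08-31T03:30Z) DERIVABLE from print: `#Fix(σ₂σ_N on Cls O) = tr(σ₂σ_N | ℤ[S]) =
1 + tr(−W₂·W_N | S₂^{new}(Γ₀(2N)))` (Eichler–Jacquet–Langlands with the sign flipped at the ramified prime `2` and kept at the Eichler prime `N` — table 168/168:
`σ₂φ_A = a₂(A)φ_A`, `σ_Nφ_A = −a_N(A)φ_A`), the `N`-old space contributes trace `0` to `W_{2N}`, and Lefschetz with Ogg's count `#Fix(w_{2N} on X₀(2N)) = h(−8N)`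
(`2N ≡ 2 mod 4`) gives `tr(W_{2N} | S₂(2N)) = 1 − h(−8N)/2`, whence `#X′ = h(−8N)/2` (so every genus-CM class hosts exactly one `±`-pair of `ℤ[√−2N]`-embeddings,
since Eichler's trace formula gives `Σ_[J] m_J = h(−8N)`); no Prop below uses the halving. -/
def IsGenusCMIdeal (N : ℕ) (J : Submodule ℤ ℍ[ℚ]) : Prop :=
  ∃ x : ℍ[ℚ], x * x = -((2 * N : ℕ) : ℍ[ℚ]) ∧ ∀ y ∈ J, x * y ∈ J

/-! ## (A) The real-locus laws — THEOREM-GRADE targets -/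

/-- **ES-42A₁ `GrossPeriodVanishesOfNegativeRootNumberAtTwo` — ODD SIGN KILLS THE PERIOD EXACTLY (theorem-grade).**
Common binders (all Props below): `A` minimal elliptic of conductor `2N`, `N` an odd prime; `K` imaginary quadratic, `d_K < −4`, `d_K ≡ 5 (mod 8)` (`2` inert),
Heegner for `N`; `O` Eichler of level `N`, `RI` its right ideals, `φ` a `2`-primitive integral eigenform of `A`; `(ψ, I, rep)` a Gross point.  THEN `w(A) = −1 ⇒
T(φ,K) = 0` (as an integer, every orientation).  Proof (MEMO-es §42.2): the involution `τ = W₂W_N ∘ conj` preserves the divisor `Σ_{Pic} [ψ(𝔞)I]` and `φ∘W₂W_N =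
w(A)φ`.  TABLE: 730/730 cells with `w = −1` have `T = 0` in all four orientations.  Why it might fail: only through a sign-convention error in `φ∘W₂W_N = w(A)φ`
(Jacquet–Langlands flips the Atkin–Lehner sign exactly at the ramified prime `2`; engine check `W2_sign·WN_sign = −a₂a_N = w(A)` 168/168).
[cite: Gross1987, §3 (11), Prop. 10.3] -/
def GrossPeriodVanishesOfNegativeRootNumberAtTwo : Prop :=
  ∀ (A : WeierstrassCurve ℚ) [A.IsElliptic] [A.IsGloballyMinimal] (N : ℕ), N.Prime → Odd N → A.conductorNorm ℤ = 2 * N → A.rootNumber = -1 →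
    ∀ (K : Type) [Field K] [NumberField K], IsImaginaryQuadratic K → NumberField.discr K < -4 → NumberField.discr K % 8 = 5 →
      SatisfiesHeegnerHypothesis N K →
    ∀ (O : Subring ℍ[ℚ]) (RI : Set (Submodule ℤ ℍ[ℚ])) (φ : Submodule ℤ ℍ[ℚ] → ℤ),
      IsEichlerOrder N O → IsRightIdealSet O RI → IsIntegralEigenform A N O RI φ →
    ∀ (ψ : K →ₐ[ℚ] ℍ[ℚ]) (I : Submodule ℤ ℍ[ℚ]) (rep : ClassGroup (𝓞 K) → nonZeroDivisors (Ideal (𝓞 K))),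
      GrossPoint RI K ψ I rep →
    grossPeriod φ K ψ I rep = 0

/-- **ES-42A₂ `GrossPeriodEvenOfEvenOnGenusCMAtTwo` — THE PERIOD MOD 2 LIVES ON THE GENUS-CM CLASSES (theorem-grade).**
Common binders.  IF `φ` is even on every genus-CM ideal of `RI` THEN `T(φ,K)` is even (every `2`-inert door, prime or composite, every orientation, both signs).
Proof: `T ≡ Σ_{Fix τ} φ` and a `τ`-fixed oriented point is a pair of anticommuting `b² = d_K`, `x² = −2N` in one left order, so its class is genus-CM.
TABLE: 321/321 `(g,D)` cells with `φ̄|X′ ≡ 0` have all four `T` even.  Why it might fail: as A₁ (it is the same involution count).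
[cite: Gross1987, §3, §11] -/
def GrossPeriodEvenOfEvenOnGenusCMAtTwo : Prop :=
  ∀ (A : WeierstrassCurve ℚ) [A.IsElliptic] [A.IsGloballyMinimal] (N : ℕ), N.Prime → Odd N → A.conductorNorm ℤ = 2 * N →
    ∀ (K : Type) [Field K] [NumberField K], IsImaginaryQuadratic K → NumberField.discr K < -4 → NumberField.discr K % 8 = 5 →
      SatisfiesHeegnerHypothesis N K →
    ∀ (O : Subring ℍ[ℚ]) (RI : Set (Submodule ℤ ℍ[ℚ])) (φ : Submodule ℤ ℍ[ℚ] → ℤ),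
      IsEichlerOrder N O → IsRightIdealSet O RI → IsIntegralEigenform A N O RI φ →
      (∀ J ∈ RI, IsGenusCMIdeal N J → Even (φ J)) →
    ∀ (ψ : K →ₐ[ℚ] ℍ[ℚ]) (I : Submodule ℤ ℍ[ℚ]) (rep : ClassGroup (𝓞 K) → nonZeroDivisors (Ideal (𝓞 K))),
      GrossPoint RI K ψ I rep →
    Even (grossPeriod φ K ψ I rep)

/-- **ES-42A₃ `GrossPeriodOddPrimeDoorOfOddOnGenusCMAtTwo` — AT A PRIME DOOR THE REAL LOCUS IS ONE POINT (theorem-grade).**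
Common binders with `|d_K| = q` PRIME.  IF `φ` is odd on every genus-CM ideal THEN `T(φ,K)` is odd.  Proof: `h(−q)` is odd, so `τ` has exactly
`#Pic(𝒪_K)[2] = 1` fixed point on the divisor and `T ≡ φ(that genus-CM class)`; (for `w(A) = −1` the hypothesis is impossible: `φ` vanishes on `X′`).
TABLE: every eigenvector with `φ̄|X′ ≡ 1` (the 6 Eisenstein `N ≡ 7 (8)` forms; no dihedral `φ̄|X′` is constant) has all prime-door `T` odd: 29/29 cells (28/28 after
the defect filter of CensusES42 §0).
Why it might fail: a prime door whose divisor meets a genus-CM class hosting two `±`-pairs of `K′`-embeddings (excluded iff `#X′ = h(−8N)/2`, 112/112 levels).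
[cite: Gross1987, §3, §11] -/
def GrossPeriodOddPrimeDoorOfOddOnGenusCMAtTwo : Prop :=
  ∀ (A : WeierstrassCurve ℚ) [A.IsElliptic] [A.IsGloballyMinimal] (N : ℕ), N.Prime → Odd N → A.conductorNorm ℤ = 2 * N →
    ∀ (K : Type) [Field K] [NumberField K], IsImaginaryQuadratic K → NumberField.discr K < -4 → NumberField.discr K % 8 = 5 →
      SatisfiesHeegnerHypothesis N K → (NumberField.discr K).natAbs.Prime →
    ∀ (O : Subring ℍ[ℚ]) (RI : Set (Submodule ℤ ℍ[ℚ])) (φ : Submodule ℤ ℍ[ℚ] → ℤ),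
      IsEichlerOrder N O → IsRightIdealSet O RI → IsIntegralEigenform A N O RI φ →
      (∀ J ∈ RI, IsGenusCMIdeal N J → Odd (φ J)) →
    ∀ (ψ : K →ₐ[ℚ] ℍ[ℚ]) (I : Submodule ℤ ℍ[ℚ]) (rep : ClassGroup (𝓞 K) → nonZeroDivisors (Ideal (𝓞 K))),
      GrossPoint RI K ψ I rep →
    Odd (grossPeriod φ K ψ I rep)

/-- **ES-42A₄ `GrossPeriodParityFrobeniusClassAtTwo` — THE PARITY AT A PRIME DOOR IS A CLASS FUNCTION ON `Cl(ℚ(√−2N))` (theorem-grade; the explicit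
«real-locus mechanism» REF2 g70 asked for).**  Common binders for ONE `(A, N, O, RI, φ)` and TWO prime doors `K₁ = ℚ(√−q₁)`, `K₂ = ℚ(√−q₂)` with Gross points;
`K′` the imaginary quadratic field of discriminant `−8N`; `𝔮ᵢ` an ideal of `𝒪_{K′}` of norm `qᵢ` (a degree-one prime over `qᵢ`, which splits in `K′`).  IF
`[𝔮₁] = [𝔮₂]^{±1}` in `Cl(𝒪_{K′})` THEN `T(φ,K₁) ≡ T(φ,K₂) (mod 2)` (any orientations).  Proof: the unique `τ`-fixed point of the door `−q` is the `K′`-CM point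
`x₀^σ` with `σ² = C·[𝔮]^{±1}` (`C` independent of `q`), and `φ̄(x₀^{σγ}) = φ̄(x₀^σ)` for the `2`-torsion class `γ = [𝔭₂]` (it acts as `W₂`).  TABLE: 56/56 groups of
prime doors sharing `{[𝔮],[𝔮]⁻¹}` at one level carry one parity per eigenvector (513 prime-door cells, 112 levels).  Why it might fail: as A₃.
[cite: Gross1987, §3 (11)] -/
def GrossPeriodParityFrobeniusClassAtTwo : Prop :=
  ∀ (A : WeierstrassCurve ℚ) [A.IsElliptic] [A.IsGloballyMinimal] (N : ℕ), N.Prime → Odd N → A.conductorNorm ℤ = 2 * N →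
    ∀ (O : Subring ℍ[ℚ]) (RI : Set (Submodule ℤ ℍ[ℚ])) (φ : Submodule ℤ ℍ[ℚ] → ℤ),
      IsEichlerOrder N O → IsRightIdealSet O RI → IsIntegralEigenform A N O RI φ →
    ∀ (K' : Type) [Field K'] [NumberField K'], IsImaginaryQuadratic K' → NumberField.discr K' = -(8 * N) →
    ∀ (K₁ : Type) [Field K₁] [NumberField K₁] (K₂ : Type) [Field K₂] [NumberField K₂],
      IsImaginaryQuadratic K₁ → NumberField.discr K₁ < -4 → NumberField.discr K₁ % 8 = 5 → SatisfiesHeegnerHypothesis N K₁ → (NumberField.discr K₁).natAbs.Prime →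
      IsImaginaryQuadratic K₂ → NumberField.discr K₂ < -4 → NumberField.discr K₂ % 8 = 5 → SatisfiesHeegnerHypothesis N K₂ → (NumberField.discr K₂).natAbs.Prime →
    ∀ (𝔮₁ 𝔮₂ : nonZeroDivisors (Ideal (𝓞 K'))),
      Ideal.absNorm (𝔮₁ : Ideal (𝓞 K')) = (NumberField.discr K₁).natAbs → Ideal.absNorm (𝔮₂ : Ideal (𝓞 K')) = (NumberField.discr K₂).natAbs →
      (ClassGroup.mk0 𝔮₁ = ClassGroup.mk0 𝔮₂ ∨ ClassGroup.mk0 𝔮₁ = (ClassGroup.mk0 𝔮₂)⁻¹) →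
    ∀ (ψ₁ : K₁ →ₐ[ℚ] ℍ[ℚ]) (I₁ : Submodule ℤ ℍ[ℚ]) (rep₁ : ClassGroup (𝓞 K₁) → nonZeroDivisors (Ideal (𝓞 K₁)))
      (ψ₂ : K₂ →ₐ[ℚ] ℍ[ℚ]) (I₂ : Submodule ℤ ℍ[ℚ]) (rep₂ : ClassGroup (𝓞 K₂) → nonZeroDivisors (Ideal (𝓞 K₂))),
      GrossPoint RI K₁ ψ₁ I₁ rep₁ → GrossPoint RI K₂ ψ₂ I₂ rep₂ →
    (Even (grossPeriod φ K₁ ψ₁ I₁ rep₁) ↔ Even (grossPeriod φ K₂ ψ₂ I₂ rep₂))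

/-! ## (B) The Hecke recursion on the genus-CM locus — THEOREM-GRADE, the lens's main new target -/

/-- **ES-42B `EigenformEvenOnGenusCMOfInertOddTraceAtTwo` — ONE INERT PRIME WITH ODD TRACE KILLS `φ̄` ON THE GENUS-CM LOCUS (theorem-grade).**
`A` minimal elliptic of conductor `2N`, `N` an odd prime, `O` Eichler of level `N`, `RI`, `φ` a `2`-primitive integral eigenform of `A`.  IF there is a prime
`ℓ ∤ 2N` INERT in `ℚ(√−2N)` (`−2N` a non-square mod `ℓ`) with `a_ℓ(A)` ODD, THEN `φ(J)` is even for every genus-CM `J ∈ RI`.  Proof (MEMO-es §42.3): the `ℓ+1`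
Brandt neighbours of a genus-CM class are the conductor-`ℓ` CM points over it, a free orbit of the cyclic group `(𝒪_{K′}/ℓ)^×/𝔽_ℓ^×` of even order `ℓ+1` whose
involution `[√−2N mod ℓ]` acts as the global `W₂W_N` (adelic bookkeeping: the idele `(√−2N)_ℓ` differs from the principal idele by `Π₂⁻¹w_N⁻¹·units`), and
`φ∘W₂W_N = ±φ`; summing, `a_ℓ(A)φ(J) = Σ_{pairs}(φ(j) ± φ(j)) ≡ 0 (mod 2)`.  No door, no `L`-value enters.  TABLE: 117/117 eigenvectors (`N ≤ 2953`) having such an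
`ℓ` (always one `≤ 47`) are even on all `h(−8N)/2` genus-CM classes; the 15 big-image eigenvectors WITHOUT such `ℓ` (`ρ̄_{A,2}` induced from `ℚ(√−2N)`) are odd
somewhere on `X′` in 12 cases (the 3 exceptions have `L(A,1) = 0`).  COROLLARIES with A₂ and Chebotarev: `T(φ,K)` even at every `2`-inert door whenever `ρ̄_{A,2}`
is irreducible and not induced from `ℚ(√−2N)` — in particular ES-41 E♯ (`A(ℚ)[2] = 0`, `v₂(Δ_A)` even: 268/268 cells) and ES-41 R♭ (`v₂(Δ_A)` odd, `Δ_A > 0`: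
29/29) with their `W`-free hypotheses, upgrading both from conjecture to consequences of this target.  Why it might fail: the identification of the local
involution with the GLOBAL `W₂W_N` on classes uses that `B` is ramified exactly at `{2,∞}` and `O` has level exactly `N`; a second Eichler prime or `4 ∣` level
changes the normaliser bookkeeping (not claimed).  [cite: Gross1987, §3 (11), (3.7)–(3.10) (action of Pic on CM points, Hecke neighbours)] -/
def EigenformEvenOnGenusCMOfInertOddTraceAtTwo : Prop :=
  ∀ (A : WeierstrassCurve ℚ) [A.IsElliptic] [A.IsGloballyMinimal] (N : ℕ), N.Prime → Odd N → A.conductorNorm ℤ = 2 * N →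
    ∀ (O : Subring ℍ[ℚ]) (RI : Set (Submodule ℤ ℍ[ℚ])) (φ : Submodule ℤ ℍ[ℚ] → ℤ),
      IsEichlerOrder N O → IsRightIdealSet O RI → IsIntegralEigenform A N O RI φ →
      (∃ ℓ : ℕ, ℓ.Prime ∧ ¬ ℓ ∣ 2 * N ∧ ¬ IsSquare ((-(2 * N : ℤ) : ZMod ℓ)) ∧ Odd (A.frobeniusTrace ℓ)) →
    ∀ J ∈ RI, IsGenusCMIdeal N J → Even (φ J)

/-- **ES-42B′ `GrossPeriodEvenOfInertOddTraceAtTwo` — the door-level form of B (B ∧ A₂; theorem-grade).**  Common binders.  IF some prime `ℓ ∤ 2N` inert in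
`ℚ(√−2N)` has `a_ℓ(A)` odd THEN `T(φ,K)` is even — every `2`-inert Heegner door (prime or composite `d_K`), every orientation, both root numbers.
TABLE: 297/297 cells with `w(A) = +1` (41 eigenvectors: all 100 peu-ramifié-type and 4 très-ramifié `Δ_A > 0` curves of ES-41 among them) + 730/730 `w = −1` cells;
0 odd periods.  Why it might fail: as B.  [cite: Gross1987, §3, §11] -/
def GrossPeriodEvenOfInertOddTraceAtTwo : Prop :=
  ∀ (A : WeierstrassCurve ℚ) [A.IsElliptic] [A.IsGloballyMinimal] (N : ℕ), N.Prime → Odd N → A.conductorNorm ℤ = 2 * N →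
    (∃ ℓ : ℕ, ℓ.Prime ∧ ¬ ℓ ∣ 2 * N ∧ ¬ IsSquare ((-(2 * N : ℤ) : ZMod ℓ)) ∧ Odd (A.frobeniusTrace ℓ)) →
    ∀ (K : Type) [Field K] [NumberField K], IsImaginaryQuadratic K → NumberField.discr K < -4 → NumberField.discr K % 8 = 5 →
      SatisfiesHeegnerHypothesis N K →
    ∀ (O : Subring ℍ[ℚ]) (RI : Set (Submodule ℤ ℍ[ℚ])) (φ : Submodule ℤ ℍ[ℚ] → ℤ),
      IsEichlerOrder N O → IsRightIdealSet O RI → IsIntegralEigenform A N O RI φ →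
    ∀ (ψ : K →ₐ[ℚ] ℍ[ℚ]) (I : Submodule ℤ ℍ[ℚ]) (rep : ClassGroup (𝓞 K) → nonZeroDivisors (Ideal (𝓞 K))),
      GrossPoint RI K ψ I rep →
    Even (grossPeriod φ K ψ I rep)

/-! ## (C) The dihedral residue — CONJECTURE (the only non-theorem-grade law; it carries all odd periods of big-image curves) -/

/-- **ES-42C `OddGrossPeriodIffSplitOddTracesDihedralAtTwo` — FOR `ℚ(√−2N)`-DIHEDRAL CURVES OF ANALYTIC RANK 0 THE PERIOD IS ODD EXACTLY AT THE DOORS WHOSE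
PRIMES SPLIT IN `ℚ(√−2N)` WITH ODD TRACES (CONJECTURE).**  Common binders with `A(ℚ)[2] = 0`, `v₂(Δ_A)` odd, `v_N(Δ_A)` odd and `Δ_A < 0` (i.e. the squarefree kernel of `Δ_A` is
`−2N`, so `ρ̄_{A,2}` is induced from `K′ = ℚ(√−2N) = ℚ(√Δ_A)`: très ramifié at `2`, connected real locus; without `v_N` odd the resolvent would be `ℚ(√−2)` and B
would force every period even) and `r_an(A) = 0`.  THEN `T(φ,K)` is odd ⟺ every prime `q ∣ d_K` has `−2N` a square mod `q` and `a_q(A)`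
odd (for prime `|d_K|` the splitting is automatic, so: `T(−q)` odd ⟺ `a_q(A)` odd ⟺ `Frob_q` has order 3 on `A[2]`).  Structure behind it (MEMO-es §42.4): B's
recursion forces `φ̄|X′ = Tr(λ·χ₀)` with `χ₀` the cubic character of `Cl(−8N)` cutting out `ℚ(A[2])`, so the law ⟺ `λ ≠ 0`; `λ = 0` is forced when `L(A,1) = 0`.
TABLE (12 curves 38a, 38b, 106a, 106d, 202a, 358a, 358b, 718a, 2342b, 2518b, 2518c, 3254b): prime doors 50/50 (`a_q` odd & `T` odd 39, both even 11), composite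
doors 39/39; the 3 rank-2 dihedral curves (2038a, 5906b, 5906c) have all 24 cells even.  CONSEQUENCE (Gross + BSD shape): `L(A^{(−q)},1) ≠ 0` for every prime
`q ≡ 3 (mod 8)` with `(−q/N) = 1` and `a_q(A)` odd — density `2/3` of the admissible `q`; nearest print: Kriz–Li arXiv:1606.03172 Thm 1.4 / arXiv:1710.00294 Thm 1.4
(`a_ℓ` odd, but `2` SPLIT in the Heegner field and hypothesis (★) on a `2`-adic logarithm), Zhai doi:10.4310/ajm.2016.v20.n3.a4, Coates–Li–Tian–Zhai
doi:10.1112/plms/pdu059 (modular-symbol side).  Why it might fail: a dihedral rank-0 `A` with `Ш(A)[2] ≠ 0` or `2 ∣ c_N(A)·#A^{(−q)}(ℚ)_{tors}`-type global floor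
making `λ = 0` although `L(A,1) ≠ 0` (none with `N ≤ 2953`; kit ask D-es-104).  [cite: Gross1987, Prop. 11.2, §11] -/
@[conjecture] def OddGrossPeriodIffSplitOddTracesDihedralAtTwo : Prop :=
  ∀ (A : WeierstrassCurve ℚ) [A.IsElliptic] [A.IsGloballyMinimal] (N : ℕ), N.Prime → Odd N → A.conductorNorm ℤ = 2 * N →
    (∀ Q : (A.baseChange ℚ).toAffine.Point, 2 • Q = 0 → Q = 0) → Odd (padicValRat 2 A.Δ) → Odd (padicValRat N A.Δ) → A.Δ < 0 →
    A.analyticRank = 0 →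
    ∀ (K : Type) [Field K] [NumberField K], IsImaginaryQuadratic K → NumberField.discr K < -4 → NumberField.discr K % 8 = 5 →
      SatisfiesHeegnerHypothesis N K →
    ∀ (O : Subring ℍ[ℚ]) (RI : Set (Submodule ℤ ℍ[ℚ])) (φ : Submodule ℤ ℍ[ℚ] → ℤ),
      IsEichlerOrder N O → IsRightIdealSet O RI → IsIntegralEigenform A N O RI φ →
    ∀ (ψ : K →ₐ[ℚ] ℍ[ℚ]) (I : Submodule ℤ ℍ[ℚ]) (rep : ClassGroup (𝓞 K) → nonZeroDivisors (Ideal (𝓞 K))),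
      GrossPoint RI K ψ I rep →
    (Odd (grossPeriod φ K ψ I rep) ↔
      ∀ q : ℕ, q.Prime → (q : ℤ) ∣ NumberField.discr K → IsSquare ((-(2 * N : ℤ) : ZMod q)) ∧ Odd (A.frobeniusTrace q))

/-! ## (D) Eisenstein laws (`A(ℚ)[2] ≠ 0`; in the table only `N ≡ ±1 (mod 8)` occur) -/

/-- **ES-42D₇ `EigenformOddOfRationalTwoTorsionSevenModEightAtTwo` — AT `N ≡ 7 (mod 8)` THE EISENSTEIN CONGRUENCE SATURATES: `φ ≡ 𝟙 (mod 2)` (finite-type law).**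
`A` minimal elliptic of conductor `2N`, `N` prime, `N ≡ 7 (mod 8)`, with a rational point of order `2`; `O`, `RI`, `φ` as above.  THEN `φ(J)` is odd for EVERY `J ∈ RI`
(so by A₁–A₃: `T(φ,K) ≡ h(d_K)`, odd exactly at prime doors — 28/28 prime, 16/16 composite cells).  TABLE: 6/6 eigenvectors (158e, 862c, 1006b, 2878b, 3214b, 4286d)
odd on all `h` classes.  Mechanism: `ā_ℓ = 1+ℓ = 0` makes `φ̄` constant on the genera of `X′`; for `N ≡ 7 (8)` the `2`-torsion class `[𝔭₂]` is a square but the door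
classes are not (`N ≡ 3 mod 4`), which forces one value; saturation to all of `S` is the empirical extra.  Why it might fail: a level `2N`, `N ≡ 7 (8)`, where the
mod-`2` Eisenstein eigenspace of the Brandt module has dimension `≥ 2` and the rational newform picks a non-constant vector (Mazur's Eisenstein ideal at `2` is
trivial at prime level `N ≢ 1 (8)`, but level `2N` is not covered).  [cite: Gross1987, §3] -/
def EigenformOddOfRationalTwoTorsionSevenModEightAtTwo : Prop :=
  ∀ (A : WeierstrassCurve ℚ) [A.IsElliptic] [A.IsGloballyMinimal] (N : ℕ), N.Prime → N % 8 = 7 → A.conductorNorm ℤ = 2 * N →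
    (∃ Q : (A.baseChange ℚ).toAffine.Point, Q ≠ 0 ∧ 2 • Q = 0) →
    ∀ (O : Subring ℍ[ℚ]) (RI : Set (Submodule ℤ ℍ[ℚ])) (φ : Submodule ℤ ℍ[ℚ] → ℤ),
      IsEichlerOrder N O → IsRightIdealSet O RI → IsIntegralEigenform A N O RI φ →
    ∀ J ∈ RI, Odd (φ J)

/-- **ES-42D₁ `GrossPeriodParitySpinClassOneModEightAtTwo` — AT `N ≡ 1 (mod 8)` THE PARITY IS A FUNCTION OF THE CLASS MODULO FOURTH POWERS (spin law).**
As A₄ (one `(A,N,O,RI,φ)`, two prime doors, `K′` of discriminant `−8N`, `𝔮ᵢ` of norm `qᵢ`) with `A(ℚ)[2] ≠ 0` and `N ≡ 1 (mod 8)`.  IF `[𝔮₁][𝔮₂]^{±1}` is a FOURTH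
power in `Cl(𝒪_{K′})` THEN `T(φ,K₁) ≡ T(φ,K₂) (mod 2)`.  Mechanism: `φ̄|X′` is constant on the two genera of the torsor `X′` (`ā_ℓ = 0` recursion) and the fixed point
of the door `−q` lies in the genus of `√(C[𝔮])`, defined modulo `Pic⁴` because `[𝔭₂] ∈ Pic²` exactly when `N ≡ ±1 (8)` (Rédei); so the parity is an `8`-rank /
spin symbol of `q` in `ℚ(√−2N)`.  TABLE: 6 eigenvectors (34a, 178b, 2866a, 4178b, 4786b + one constant), 22/22 related prime-door pairs agree (and 5/6 forms DO take
both parities, so no coarser law holds); composite doors: 9/9 follow `T(−q₁q₂) ≡ [c_{q₂} ∉ Pic²]·[φ̄ non-constant]`, inert factor ⇒ even 7/7.  Why it might fail: a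
level where `φ̄|X′` is constant on genera only up to the `W₂`-sign subtlety at classes with extra units (`w_i > 1` classes occur on `X′` at `N = 17, 89, 2089`).
[cite: Gross1987, §3 (11)] -/
def GrossPeriodParitySpinClassOneModEightAtTwo : Prop :=
  ∀ (A : WeierstrassCurve ℚ) [A.IsElliptic] [A.IsGloballyMinimal] (N : ℕ), N.Prime → N % 8 = 1 → A.conductorNorm ℤ = 2 * N →
    (∃ Q : (A.baseChange ℚ).toAffine.Point, Q ≠ 0 ∧ 2 • Q = 0) →
    ∀ (O : Subring ℍ[ℚ]) (RI : Set (Submodule ℤ ℍ[ℚ])) (φ : Submodule ℤ ℍ[ℚ] → ℤ),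
      IsEichlerOrder N O → IsRightIdealSet O RI → IsIntegralEigenform A N O RI φ →
    ∀ (K' : Type) [Field K'] [NumberField K'], IsImaginaryQuadratic K' → NumberField.discr K' = -(8 * N) →
    ∀ (K₁ : Type) [Field K₁] [NumberField K₁] (K₂ : Type) [Field K₂] [NumberField K₂],
      IsImaginaryQuadratic K₁ → NumberField.discr K₁ < -4 → NumberField.discr K₁ % 8 = 5 → SatisfiesHeegnerHypothesis N K₁ → (NumberField.discr K₁).natAbs.Prime →
      IsImaginaryQuadratic K₂ → NumberField.discr K₂ < -4 → NumberField.discr K₂ % 8 = 5 → SatisfiesHeegnerHypothesis N K₂ → (NumberField.discr K₂).natAbs.Prime →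
    ∀ (𝔮₁ 𝔮₂ : nonZeroDivisors (Ideal (𝓞 K'))),
      Ideal.absNorm (𝔮₁ : Ideal (𝓞 K')) = (NumberField.discr K₁).natAbs → Ideal.absNorm (𝔮₂ : Ideal (𝓞 K')) = (NumberField.discr K₂).natAbs →
      (∃ c : ClassGroup (𝓞 K'), ClassGroup.mk0 𝔮₁ * ClassGroup.mk0 𝔮₂ = c ^ 4 ∨ ClassGroup.mk0 𝔮₁ = ClassGroup.mk0 𝔮₂ * c ^ 4) →
    ∀ (ψ₁ : K₁ →ₐ[ℚ] ℍ[ℚ]) (I₁ : Submodule ℤ ℍ[ℚ]) (rep₁ : ClassGroup (𝓞 K₁) → nonZeroDivisors (Ideal (𝓞 K₁)))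
      (ψ₂ : K₂ →ₐ[ℚ] ℍ[ℚ]) (I₂ : Submodule ℤ ℍ[ℚ]) (rep₂ : ClassGroup (𝓞 K₂) → nonZeroDivisors (Ideal (𝓞 K₂))),
      GrossPoint RI K₁ ψ₁ I₁ rep₁ → GrossPoint RI K₂ ψ₂ I₂ rep₂ →
    (Even (grossPeriod φ K₁ ψ₁ I₁ rep₁) ↔ Even (grossPeriod φ K₂ ψ₂ I₂ rep₂))

/-! ## (F) Skeleton of B — the elementary core B♭ and its three feeder statements (turnkey line for a prover)

`IsIntegralEigenform` states the Hecke relation at `ℓ ∤ 2N` but NOT the Atkin–Lehner sign `φ∘W₂W_N = ±φ` used in the proof of B; section (F) isolates it.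
`W₂W_N` on right `O`-ideals is `J ↦ J·𝔐` for THE two-sided `O`-ideal `𝔐` with `𝔐² = 2N·O` (unique: locally `𝔓₂` at `2`, `O_N w_N` at `N`, trivial elsewhere).
B = S₀ ∘ S₁ ∘ S₂ ∘ B♭ (`eigenformEvenOnGenusCM_of`, sorry-free): S₀ existence of `𝔐` (routine), S₁ «left multiplication by a genus-CM element `u` IS right
translation by `𝔐`» (Lemma 1 of MEMO-es §42.3, local at `2` and `N`), S₂ the sign (Jacquet–Langlands strong multiplicity one for the Brandt module: Literature-fact
grade), B♭ the purely combinatorial core (free involution on the `ℓ+1` neighbours). -/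

/-- `M` is THE ATKIN–LEHNER IDEAL of `O` at `2N`: an integral two-sided `O`-ideal with `M·M = (2N)·O`. -/
def IsALIdeal (N : ℕ) (O : Subring ℍ[ℚ]) (M : Submodule ℤ ℍ[ℚ]) : Prop :=
  M ≤ AddSubgroup.toIntSubmodule O.toAddSubgroup ∧
  (∀ x ∈ O, ∀ m ∈ M, x * m ∈ M ∧ m * x ∈ M) ∧
  M * M = Submodule.span ℤ {((2 * N : ℕ) : ℍ[ℚ])} * AddSubgroup.toIntSubmodule O.toAddSubgroup

/-- **ES-42S₀ `ALIdealExistsAtTwo` (support, routine).**  An Eichler order of odd prime level `N` in `ℍ[ℚ]` has an Atkin–Lehner ideal `M` at `2N`, and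
`J ↦ J·M` preserves the set of invertible right `O`-ideals.  [cite: Voight, Quaternion Algebras, §23.3 (two-sided ideals of Eichler orders), §28.9] -/
def ALIdealExistsAtTwo : Prop :=
  ∀ (N : ℕ) (O : Subring ℍ[ℚ]), N.Prime → Odd N → IsEichlerOrder N O →
    ∃ M : Submodule ℤ ℍ[ℚ], IsALIdeal N O M ∧
      ∀ RI : Set (Submodule ℤ ℍ[ℚ]), IsRightIdealSet O RI → ∀ J ∈ RI, J * M ∈ RI

/-- **ES-42S₁ `GenusCMLeftMulEqALIdealAtTwo` (support, M-sized; Lemma 1 of MEMO-es §42.3).**  If `u² = −2N` and `uJ ⊆ J` for an invertible right `O`-ideal `J`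
(`O` Eichler of odd prime level `N` in `ℍ[ℚ]`), then `uJ = J·M`: locally `u` is a uniformiser of the division algebra at `2`, `w_N·k` with `k ∈ O_N^×` at `N`
(because `ℤ_N[u]` is the maximal order of the ramified field `ℚ_N(√−2N)`, optimally embedded), and a unit elsewhere.  Why it might fail: only if `IsEichlerOrder` /
`IsRightIdealSet` as typed admit a non-Eichler witness (REF1 A-audit of ES-40 found none). -/
def GenusCMLeftMulEqALIdealAtTwo : Prop :=
  ∀ (N : ℕ) (O : Subring ℍ[ℚ]) (RI : Set (Submodule ℤ ℍ[ℚ])) (M : Submodule ℤ ℍ[ℚ]),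
    N.Prime → Odd N → IsEichlerOrder N O → IsRightIdealSet O RI → IsALIdeal N O M →
    ∀ J ∈ RI, ∀ u : ℍ[ℚ], u * u = -((2 * N : ℕ) : ℍ[ℚ]) → (∀ y ∈ J, u * y ∈ J) →
      J.map (AddMonoidHom.mulLeft u).toIntLinearMap = J * M

/-- **ES-42S₂ `EigenformALSignAtTwo` (support, Literature-fact grade).**  A `2`-primitive integral eigenform of `A` (conductor `2N`) on the right ideals of an
Eichler order of level `N` in `ℍ[ℚ]` is an eigenvector of `W₂W_N : J ↦ J·M` with eigenvalue `±1`.  Reason: by Jacquet–Langlands and strong multiplicity one the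
`{a_ℓ(A)}_{ℓ∤2N}`-eigenspace of the Brandt module is a line (every newform of level `2N` occurs once; `S₂(Γ₀(2)) = 0`, so no oldforms), stable under the
involution `W₂W_N`, which commutes with all `T_ℓ`.  (The sign is `ε₂ε_N = −a₂(A)a_N(A) = w(A)`; not needed here.)  Why it might fail: not at all if the Brandt
module as cut out by `IsRightIdealSet`/`IsIntegralEigenform` is the classical one; to be discharged from a statement-only Literature fact (JL for definite
quaternion algebras).  [cite: Voight, Quaternion Algebras, Thm 41.2.11-type (Eichler–JL correspondence); Gross1987 §5] -/
def EigenformALSignAtTwo : Prop :=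
  ∀ (A : WeierstrassCurve ℚ) [A.IsElliptic] [A.IsGloballyMinimal] (N : ℕ), N.Prime → Odd N → A.conductorNorm ℤ = 2 * N →
    ∀ (O : Subring ℍ[ℚ]) (RI : Set (Submodule ℤ ℍ[ℚ])) (φ : Submodule ℤ ℍ[ℚ] → ℤ) (M : Submodule ℤ ℍ[ℚ]),
      IsEichlerOrder N O → IsRightIdealSet O RI → IsIntegralEigenform A N O RI φ → IsALIdeal N O M →
      ∃ ε : ℤ, (ε = 1 ∨ ε = -1) ∧ ∀ J ∈ RI, φ (J * M) = ε * φ J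

/-- **ES-42B♭ `EigenformEvenOnGenusCMOfInertOddTraceSignedAtTwo` — THE COMBINATORIAL CORE OF B (theorem-grade, elementary).**  B with three extra data:
an Atkin–Lehner ideal `M` with `RI·M ⊆ RI`, the sign `φ(J·M) = ε φ(J)`, and Lemma 1 (`uJ = J·M` for genus-CM `J`).  Proof: for genus-CM `J` with element `u`
and a witness prime `ℓ`, the `ℓ+1` right-`O`-subideals `J_k ⊆ J` of index `ℓ²` satisfy `uJ_k = J_{σ(k)}·M` for a permutation `σ` (both sides are the index-`ℓ²`
subideals of `uJ = J·M`); `σ² = id` from `u² = −2N`, `M² = 2N·O`; `σ` has no fixed point since `uJ_k ⊆ J_k` would make `u mod ℓ` fix a line of `J/ℓJ`-type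
`ℙ¹(𝔽_ℓ)`, impossible for `X² + 2N` irreducible mod `ℓ`; hence `a_ℓ(A)φ(J) = Σ_k φ(J_k) = Σ_k φ(uJ_k) = ε Σ_k φ(J_{σ(k)})` pairs up as `(1+ε)·(…)`, even; `a_ℓ` odd
gives `φ(J)` even.  TABLE: as B (117/117 ⇒ 297/297).  Why it might fail: the subideals `J_k` must themselves lie in `RI` to apply left-invariance (true: their
right order is exactly `O`), a typing point for the prover, not a mathematical risk. [cite: Gross1987, §3–§4 (Brandt matrices as neighbour sums)] -/
def EigenformEvenOnGenusCMOfInertOddTraceSignedAtTwo : Prop :=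
  ∀ (A : WeierstrassCurve ℚ) [A.IsElliptic] [A.IsGloballyMinimal] (N : ℕ), N.Prime → Odd N → A.conductorNorm ℤ = 2 * N →
    ∀ (O : Subring ℍ[ℚ]) (RI : Set (Submodule ℤ ℍ[ℚ])) (φ : Submodule ℤ ℍ[ℚ] → ℤ),
      IsEichlerOrder N O → IsRightIdealSet O RI → IsIntegralEigenform A N O RI φ →
    ∀ (M : Submodule ℤ ℍ[ℚ]), IsALIdeal N O M → (∀ J ∈ RI, J * M ∈ RI) →
    ∀ (ε : ℤ), (ε = 1 ∨ ε = -1) → (∀ J ∈ RI, φ (J * M) = ε * φ J) →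
      (∀ J ∈ RI, ∀ u : ℍ[ℚ], u * u = -((2 * N : ℕ) : ℍ[ℚ]) → (∀ y ∈ J, u * y ∈ J) →
        J.map (AddMonoidHom.mulLeft u).toIntLinearMap = J * M) →
      (∃ ℓ : ℕ, ℓ.Prime ∧ ¬ ℓ ∣ 2 * N ∧ ¬ IsSquare ((-(2 * N : ℤ) : ZMod ℓ)) ∧ Odd (A.frobeniusTrace ℓ)) →
    ∀ J ∈ RI, IsGenusCMIdeal N J → Even (φ J)

/-! ## (G) REF2 g72 follow-ups (R-es-42a/b, 2026-08-31T03:25Z): the unit-clause variant C♭ of conjecture C, and the `2`-adic Gross norm law E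

R-es-42a (REF2): in the `K′`-dihedral class `c₂(A)`, `c_N(A)`, `#A(ℚ)_tors` are odd, so C AS TYPED (hypothesis `r_an(A) = 0` only) silently predicts `Ш(A)[2] = 0`
(or a compensating even Gross constant) for every rank-0 `K′`-dihedral `A`; the 12 curves of the table all have `L(A,1)/Ω_A = 1`, so the table cannot separate C
from C♭ := C + «`L(A,1)/Ω_A` is a `2`-adic unit».  C stays as filed (never reworded in place); C♭ is the statement to audit.  Its `L`-value shadow in the direction
⟸ is IN PRINT: Zhai, *Non-vanishing theorems for quadratic twists of elliptic curves*, Asian J. Math. 20 (2016) = arXiv:1409.0231, Thm. 1.1 (optimal `E` of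
conductor `2N`, `Δ_E < 0`, `E[2](ℚ) = 0`, `ord₂ L^alg(E,1) = 0` ⇒ `ord₂ L^alg(E^{(M)},1) = 0` for `M = ±q₁⋯q_r`, `q_i` inert in the cubic field `ℚ(E[2])⁺`,
i.e. `a_{q_i}` odd) [corpus: arxiv-1409.0231 p.2 L22–35].
R-es-42b (REF2's no-kit consistency test «tabulate `v₂(Σ_i w_i φ_A(x_i)²)`; prediction: minimum exactly on the `K′`-dihedral forms»): run (`census42d/e/f.py`).
As stated the prediction FAILS (`v₂⟨φ,φ⟩ = 1` also on 9 peu-ramifié forms, `0`/`1` on Eisenstein forms), but the normalised quantity obeys an exact law on all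
149 `A[2]`-irreducible forms with a modular degree in the table:  `v₂⟨φ,φ⟩ = v₂(deg φ_A)` iff `v₂(Δ_A)` odd (49/49: the 32 `K′`-dihedral + 17 très-ramifié
`Δ > 0` forms), `v₂⟨φ,φ⟩ < v₂(deg φ_A)` iff `v₂(Δ_A)` even (100/100) — law E below; the sharper Ribet–Takahashi shape `v₂(deg φ_A) − v₂⟨φ,φ⟩ = v₂(v₂(Δ_A)) − v₂(i₂)`
(`i₂ = gcd_{i,j}(w_iφ_i − w_jφ_j)`, Takahashi's congruence generator) holds 147/149, failing exactly at 178a and 466b (`N = 89, 233 ≡ 1 (mod 8)`, `v₂Δ = 12, 6`,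
defect one power of `2`: the map `Φ₂(J₀(2N)) → Φ₂(A)` is not zero on `2`-parts there — a mod-`2` multiplicity-one failure, cf. the `N ≡ 1 (mod 8)` anomalies behind D₁).
So the `2`-adic Gross constant separates `v₂(Δ_A)` odd from even, NOT dihedral from non-dihedral: what singles out the 15 dihedral forms is `φ̄|X′ ≠ 0` itself (B / C). -/

/-- **ES-42C♭ `OddGrossPeriodIffSplitOddTracesDihedralUnitLValueAtTwo` — conjecture C with the unit clause (REF2 R-es-42a).**  Binders of C plus
«`L(A,1)/Ω_A = a/b` with `a, b` odd» (`A.leadingLCoeff = L(A,1)` as `r_an = 0`; `A.realPeriodRat = Ω_A` with real components, `A` globally minimal); under BSD and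
the oddness of `c₂ c_N #tors²` in this class this is exactly `Ш(A)[2] = 0`.  Conclusion verbatim C.  TABLE: identical to C (50/50 prime doors, 39/39 composite; all 12
curves have `L/Ω = 1`).  Why it might fail: only through the Gross constant — a dihedral `A` with `v₂(deg φ_A/⟨φ,φ⟩) ≠ 0` (excluded on the table by law E, 32/32) or a
`2` in the Manin constant.  Direction ⟸ for the `L`-VALUES is Zhai 2016 Thm 1.1; for the PERIOD it is Zhai + Gross's formula + E.  `C → C♭` is a one-line weakening (term
`fun hC A _ _ N hN … hrk _ => hC A N hN … hrk`, checked in the seat folder and deliberately not kept here so that no theorem of this workfile concludes an obligation node).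
[cite: Gross1987, Prop. 11.2, §11] -/
@[conjecture] def OddGrossPeriodIffSplitOddTracesDihedralUnitLValueAtTwo : Prop :=
  ∀ (A : WeierstrassCurve ℚ) [A.IsElliptic] [A.IsGloballyMinimal] (N : ℕ), N.Prime → Odd N → A.conductorNorm ℤ = 2 * N →
    (∀ Q : (A.baseChange ℚ).toAffine.Point, 2 • Q = 0 → Q = 0) → Odd (padicValRat 2 A.Δ) → Odd (padicValRat N A.Δ) → A.Δ < 0 →
    A.analyticRank = 0 →
    (∃ a b : ℤ, Odd a ∧ Odd b ∧ (b : ℂ) * A.leadingLCoeff = (a : ℂ) * ((A.realPeriodRat : ℝ) : ℂ)) →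
    ∀ (K : Type) [Field K] [NumberField K], IsImaginaryQuadratic K → NumberField.discr K < -4 → NumberField.discr K % 8 = 5 →
      SatisfiesHeegnerHypothesis N K →
    ∀ (O : Subring ℍ[ℚ]) (RI : Set (Submodule ℤ ℍ[ℚ])) (φ : Submodule ℤ ℍ[ℚ] → ℤ),
      IsEichlerOrder N O → IsRightIdealSet O RI → IsIntegralEigenform A N O RI φ →
    ∀ (ψ : K →ₐ[ℚ] ℍ[ℚ]) (I : Submodule ℤ ℍ[ℚ]) (rep : ClassGroup (𝓞 K) → nonZeroDivisors (Ideal (𝓞 K))),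
      GrossPoint RI K ψ I rep →
    (Odd (grossPeriod φ K ψ I rep) ↔
      ∀ q : ℕ, q.Prime → (q : ℤ) ∣ NumberField.discr K → IsSquare ((-(2 * N : ℤ) : ZMod q)) ∧ Odd (A.frobeniusTrace q))

/-- **The Gross–Eichler weight** `w(J) = #O_l(J)^× / 2` of a right ideal `J` (`O_l(J)^× = {x : xJ = J}`, finite in a definite algebra; Gross 1987 §1: the height
pairing on `ℤ[S]` is `⟨e_i, e_j⟩ = w_i δ_ij`).  Junk value `0` if the stabiliser is infinite. -/
noncomputable def grossWeight (J : Submodule ℤ ℍ[ℚ]) : ℕ :=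
  Nat.card {x : ℍ[ℚ] // J.map (AddMonoidHom.mulLeft x).toIntLinearMap = J} / 2

/-- **ES-42E `GrossNormValuationDichotomyAtTwo` — THE `2`-ADIC GROSS NORM EQUALS THE `2`-ADIC MODULAR DEGREE EXACTLY IN THE TRÈS RAMIFIÉ CASE (empirical law,
Ribet–Takahashi shape; theorem-grade target).**  For `A` of conductor `2N` (`N` odd prime) with `A(ℚ)[2] = 0`, `φ` its `2`-primitive quaternionic eigenform and
`S ⊆ RI` a system of representatives of the right-ideal classes: `v₂(Σ_{J∈S} w(J) φ(J)²) = v₂(deg_min(A, 2N))` ⟺ `v₂(Δ_A)` odd.  TABLE (census42d–f): 49/49 `=`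
with `v₂Δ` odd, 100/100 `<` with `v₂Δ` even (19 `A[2]`-reducible forms excluded: 6 violate it).  Mechanism: `⟨φ,φ⟩ = h₂ = u_J(g₂,g₂)` for the `φ`-line of the
character group `X₂(J₀(2N)) ≅ ℤ[S]⁰` (Deligne–Rapoport/Ribet, pairing `w_iδ_ij`), and Takahashi, J. Number Theory 90 (2001), Thm. 2.3: `deg = (h₂/i₂)·j₂` with
`j₂ ∣ #Φ₂(A) = v₂(Δ_A)` [corpus: doi-10-1006-jnth-2000-2614 p.6 Thm 2.3, p.7 Thm 2.7 (`ord_ℓ j_r = ord_ℓ c_r` for `E[ℓ]` irreducible, via Ribet–Takahashi Prop. 3 =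
level-lowering)]; at `r = ℓ = 2` the needed input is level-lowering mod `2` (Buzzard) — `v₂Δ` odd ⇒ `j₂` odd and `i₂` odd (else `φ̄` Eisenstein), `v₂Δ` even ⇒
`2 ∣ j₂` (ρ̄ finite at `2` is `2`-old).  Why it might fail: a très ramifié `A` with `i₂` even, or a finite-at-`2` irreducible `ρ̄_{A,2}` for which mod-`2` level-lowering
to `Γ₀(N)` fails in the Brandt module (no example `N ≤ 2953`); `v₂` is isogeny-invariant here only because `A[2]` irreducible makes all isogeny degrees odd.
Sources: Takahashi 2001 Thm 2.3/2.7; Ribet–Takahashi doi:10.1073/pnas.94.21.11110; [cite: Gross1987, §1, Prop. 1.x (pairing)]. -/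
def GrossNormValuationDichotomyAtTwo : Prop :=
  ∀ (A : WeierstrassCurve ℚ) [A.IsElliptic] [A.IsGloballyMinimal] (N : ℕ) [NeZero (2 * N)], N.Prime → Odd N → A.conductorNorm ℤ = 2 * N →
    (∀ Q : (A.baseChange ℚ).toAffine.Point, 2 • Q = 0 → Q = 0) →
    ∀ (O : Subring ℍ[ℚ]) (RI : Set (Submodule ℤ ℍ[ℚ])) (φ : Submodule ℤ ℍ[ℚ] → ℤ),
      IsEichlerOrder N O → IsRightIdealSet O RI → IsIntegralEigenform A N O RI φ →
    ∀ S : Finset (Submodule ℤ ℍ[ℚ]), (↑S ⊆ RI) →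
      (∀ J ∈ RI, ∃! J₀, J₀ ∈ S ∧ ∃ β : ℍ[ℚ], IsUnit β ∧ J₀.map (AddMonoidHom.mulLeft β).toIntLinearMap = J) →
      minModularDegree A (2 * N) ≠ 0 →
    (padicValNat 2 (∑ J ∈ S, grossWeight J * (φ J).natAbs ^ 2) = padicValNat 2 (minModularDegree A (2 * N)) ↔ Odd (padicValRat 2 A.Δ))

/-! ## Formal links between the Props (sorry-free; they record only the logical skeleton, no arithmetic) -/

/-- B ⟹ B′ given A₂: the door-level vanishing is the class-level vanishing composed with the real-locus law. -/
theorem grossPeriodEvenOfInertOddTrace_of (hB : EigenformEvenOnGenusCMOfInertOddTraceAtTwo) (hA : GrossPeriodEvenOfEvenOnGenusCMAtTwo) :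
    GrossPeriodEvenOfInertOddTraceAtTwo := by
  intro A _ _ N hN hOdd hcond hℓ K _ _ hK hD4 hD8 hH O RI φ hO hRI hφ ψ I rep hGP
  exact hA A N hN hOdd hcond K hK hD4 hD8 hH O RI φ hO hRI hφ (hB A N hN hOdd hcond O RI φ hO hRI hφ hℓ) ψ I rep hGP

/-- D₇ ⟹ (with A₃) odd periods at every prime door for the `N ≡ 7 (8)` Eisenstein forms. -/
theorem grossPeriodOdd_sevenModEight_of (hD : EigenformOddOfRationalTwoTorsionSevenModEightAtTwo) (hA : GrossPeriodOddPrimeDoorOfOddOnGenusCMAtTwo) :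
    ∀ (A : WeierstrassCurve ℚ) [A.IsElliptic] [A.IsGloballyMinimal] (N : ℕ), N.Prime → N % 8 = 7 → A.conductorNorm ℤ = 2 * N →
      (∃ Q : (A.baseChange ℚ).toAffine.Point, Q ≠ 0 ∧ 2 • Q = 0) →
      ∀ (K : Type) [Field K] [NumberField K], IsImaginaryQuadratic K → NumberField.discr K < -4 → NumberField.discr K % 8 = 5 →
        SatisfiesHeegnerHypothesis N K → (NumberField.discr K).natAbs.Prime →
      ∀ (O : Subring ℍ[ℚ]) (RI : Set (Submodule ℤ ℍ[ℚ])) (φ : Submodule ℤ ℍ[ℚ] → ℤ),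
        IsEichlerOrder N O → IsRightIdealSet O RI → IsIntegralEigenform A N O RI φ →
      ∀ (ψ : K →ₐ[ℚ] ℍ[ℚ]) (I : Submodule ℤ ℍ[ℚ]) (rep : ClassGroup (𝓞 K) → nonZeroDivisors (Ideal (𝓞 K))),
        GrossPoint RI K ψ I rep → Odd (grossPeriod φ K ψ I rep) := by
  intro A _ _ N hN h7 hcond hQ K _ _ hK hD4 hD8 hH hq O RI φ hO hRI hφ ψ I rep hGP
  have hOddN : Odd N := by
    refine Nat.odd_iff.mpr ?_
    omega
  exact hA A N hN hOddN hcond K hK hD4 hD8 hH hq O RI φ hO hRI hφ (fun J hJ _ => hD A N hN h7 hcond hQ O RI φ hO hRI hφ J hJ) ψ I rep hGP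

/-- B = S₀ ∘ S₁ ∘ S₂ ∘ B♭: the theorem-grade target B follows from the Atkin–Lehner ideal (S₀), Lemma 1 (S₁), the JL sign (S₂) and the combinatorial core (B♭). -/
theorem eigenformEvenOnGenusCM_of (h0 : ALIdealExistsAtTwo) (h1 : GenusCMLeftMulEqALIdealAtTwo) (h2 : EigenformALSignAtTwo)
    (hflat : EigenformEvenOnGenusCMOfInertOddTraceSignedAtTwo) : EigenformEvenOnGenusCMOfInertOddTraceAtTwo := by
  intro A _ _ N hN hOdd hcond O RI φ hO hRI hφ hℓ J hJ hCM
  obtain ⟨M, hM, hRM⟩ := h0 N O hN hOdd hO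
  obtain ⟨ε, hε, hsign⟩ := h2 A N hN hOdd hcond O RI φ M hO hRI hφ hM
  exact hflat A N hN hOdd hcond O RI φ hO hRI hφ M hM (hRM RI hRI) ε hε hsign
    (fun J' hJ' u hu huJ => h1 N O RI M hN hOdd hO hRI hM J' hJ' u hu huJ) hℓ J hJ hCM

/-- Sanity for `IsGenusCMIdeal`: the zero lattice is (vacuously) genus-CM for every `N` as soon as `−2N` has a square root in `ℍ[ℚ]` — recorded to show the
predicate is about the LEFT ORDER and carries no content without `J ∈ RI` (every Prop above uses it only under `J ∈ RI`). -/
theorem isGenusCMIdeal_bot_iff (N : ℕ) : IsGenusCMIdeal N ⊥ ↔ ∃ x : ℍ[ℚ], x * x = -((2 * N : ℕ) : ℍ[ℚ]) := by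
  constructor
  · rintro ⟨x, hx, -⟩; exact ⟨x, hx⟩
  · rintro ⟨x, hx⟩; refine ⟨x, hx, ?_⟩; intro y hy
    rw [Submodule.mem_bot] at hy; subst hy; simp

/-- Sanity: `√−2` exists in `ℍ[ℚ]` (`(i+j)² = −2`), so `IsGenusCMIdeal 1 ⊥` holds — the vacuity guard above is not itself vacuous. -/
theorem isGenusCMIdeal_one_bot : IsGenusCMIdeal 1 ⊥ := by
  rw [isGenusCMIdeal_bot_iff]
  refine ⟨⟨0, 1, 1, 0⟩, ?_⟩
  rw [← Quaternion.coe_natCast]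
  ext
  · simp only [Quaternion.re_mul, Quaternion.re_neg, Quaternion.re_coe]; push_cast; norm_num
  · simp only [Quaternion.imI_mul, Quaternion.imI_neg, Quaternion.imI_coe]; norm_num
  · simp only [Quaternion.imJ_mul, Quaternion.imJ_neg, Quaternion.imJ_coe]; norm_num
  · simp only [Quaternion.imK_mul, Quaternion.imK_neg, Quaternion.imK_coe]; norm_num

end Summit.BirchSwinnertonDyer.BirchSwinnertonDyer.Theorems.RankOneAtTwoGenusFieldCMAtTwo
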